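import Summits.ResolutionOfSingularities.ResolutionOfSingularities.Theorems.FrobeniusClosingSteerFreeStepJacobianBound
import Summits.ResolutionOfSingularities.ResolutionOfSingularities.Theorems.FrobeniusClosingSteerChartMonomialSubst
import HarnessLib

/-!
# Crux `Steer` (stmt-ResolutionOfSingularities-16345), chain W4.1, hG3 / G-geom WORK-DIRECT: Lemma F♭ PART 3a — the FORMAL TELESCOPE
# (from the telescoped law `θ_M F = Ψ² + x^(M·d)·G` in `K⟦x, ỹ_M, z̃_M⟧` to the support hypothesis and the bound `τ(F) ≥ M − 1`)

OURS (campaign `res-hironaka`, rung L ★L-G4, slot W4.1; seat res-L0-w41-stub-2 g6, res-L0-w41-plan-1 RULINGs 136a/152a/152c; spec =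
res-L0-w41-tri-2 `gpd/audit_GPERF_DIRECT.md` §4 CLAIM F♭; replaces the role of no printed item; NOT a statement of the manuscript under review
[claim: Hironaka2017, status: under-review]; AI-produced, weaker than expert review).

The `M`-step free substitution `x ↦ x, ỹ ↦ x^M ỹ_M, z̃ ↦ x^M z̃_M` is the TREE map `monoidPowerSeries.substGenerators` at res-D-pv-007's chart exponents
(`…ChartMonomialSubst`, p536416: persisting letter `0`, weight `M`), whose exponent map is `G3Perf.freeShift M` (`expSum_chart_fin_three`). Hence
(res-D-pv-007's recipe, STATUS 13:58:42Z):
* `G3Perf.coeff_freeShift_substGenerators` — `coeff (freeShift M e) (θ_M F) = coeff e F` (exact transport);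
* `G3Perf.hrel_of_substGenerators_eq` — the telescoped law `θ_M F = Ψ² + x^(M·d)·G` IS the coefficientwise hypothesis `hrel` of PART 1's
  `G3Perf.free_support`;
* `G3Perf.free_support_of_substGenerators_eq` — so every odd monomial `x^a ỹ^b z̃^c` of `F` has `M·d ≤ a + M(b+c)`;
* `G3Perf.milnorLength_ge_of_substGenerators_eq` — **F♭ (formal form)**: `M − 1 ≤ τ(F) = ℓ(K⟦X⟧ ⧸ (∂ₓF, ∂_ỹF, ∂_z̃F))` for `d ≥ 2`, `M ≥ 1` (PART 2).
PART 3b (the ring-level bridge: Cohen frame of `Ŝ_M`, realisability, recognition of `Ŝ₀`, `τ < ∞` by res-L0-w41-stub-3's K1) consumes these. [folklore]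
-/

noncomputable section

set_option linter.dupNamespace false

open MvPowerSeries Literature.AlgebraicGeometry.Resolution Literature.RingTheory.MvPowerSeries Literature.RingTheory.MvPowerSeries.monoidPowerSeries
open Summit.ResolutionOfSingularities.ResolutionOfSingularities.Theorems.SwitchingDichotomy.ChartMonomialSubst

namespace Summit.ResolutionOfSingularities.ResolutionOfSingularities.Theorems.SwitchingDichotomy.G3Perf

variable {K : Type*} [CommRing K]

/-- **Exact transport along the `M`-step free substitution** `θ_M` (`x ↦ x, ỹ ↦ x^M ỹ_M, z̃ ↦ x^M z̃_M`): the coefficient of the shifted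
monomial `freeShift M e` in `θ_M F` is the coefficient of `e` in `F`. [folklore] -/
theorem coeff_freeShift_substGenerators (M : ℕ) (F : MvPowerSeries (Fin 3) K) (e : Fin 3 →₀ ℕ) :
    coeff (freeShift M e) (substGenerators (R := K) (fun i : Fin 3 => Finsupp.single i 1 + if i = 0 then 0 else M • Finsupp.single 0 1)
      (chartExp_ne_zero 0 M) F) = coeff e F := by
  rw [freeShift, ← expSum_chart_fin_three M e]
  exact coeff_substGenerators_chart_expSum 0 M F e

/-- **The telescoped law is the support hypothesis `hrel`.** If `θ_M F = Ψ² + x^(M·d)·G` in `K⟦x, ỹ_M, z̃_M⟧`, then `F` read coefficientwise in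
the stage-`M` coordinates equals `Ψ² + x^(M·d)·G` — the hypothesis `hrel` of `G3Perf.free_support`. [folklore] -/
theorem hrel_of_substGenerators_eq {M d : ℕ} {F Ψ G : MvPowerSeries (Fin 3) K}
    (h : substGenerators (R := K) (fun i : Fin 3 => Finsupp.single i 1 + if i = 0 then 0 else M • Finsupp.single 0 1)
      (chartExp_ne_zero 0 M) F = Ψ ^ 2 + X 0 ^ (M * d) * G) :
    ∀ e : Fin 3 →₀ ℕ, coeff (freeShift M e) (Ψ ^ 2 + X 0 ^ (M * d) * G) = coeff e F := fun e => by
  rw [← h]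
  exact coeff_freeShift_substGenerators M F e

variable [CharP K 2]

/-- **Support after `M` free steps** (characteristic `2`): if `θ_M F = Ψ² + x^(M·d)·G`, every ODD monomial `x^a ỹ^b z̃^c` of `F` satisfies
`M·d ≤ a + M(b+c)` (PART 1 `G3Perf.free_support`). [folklore] -/
theorem free_support_of_substGenerators_eq {M d : ℕ} {F Ψ G : MvPowerSeries (Fin 3) K}
    (h : substGenerators (R := K) (fun i : Fin 3 => Finsupp.single i 1 + if i = 0 then 0 else M • Finsupp.single 0 1)
      (chartExp_ne_zero 0 M) F = Ψ ^ 2 + X 0 ^ (M * d) * G) :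
    ∀ e : Fin 3 →₀ ℕ, (∃ i, Odd (e i)) → coeff e F ≠ 0 → M * d ≤ e 0 + M * (e 1 + e 2) :=
  fun e hodd hne => free_support F Ψ G (hrel_of_substGenerators_eq h) e hodd hne

end Summit.ResolutionOfSingularities.ResolutionOfSingularities.Theorems.SwitchingDichotomy.G3Perf

namespace Summit.ResolutionOfSingularities.ResolutionOfSingularities.Theorems.SwitchingDichotomy.G3Perf

variable {K : Type*} [Field K] [CharP K 2]

/-- **Lemma F♭, formal form (PART 3a).** In `K⟦x, ỹ, z̃⟧` over a field `K` of characteristic `2`: if `θ_M F = Ψ² + x^(M·d)·G` for the `M`-step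
free substitution `θ_M` (`x ↦ x, ỹ ↦ x^M ỹ_M, z̃ ↦ x^M z̃_M`), `2 ≤ d`, `1 ≤ M`, then
`M − 1 ≤ τ(F) := ℓ(K⟦X⟧ ⧸ (∂ₓF, ∂_ỹF, ∂_z̃F))` (PART 2 `G3Perf.milnorLength_ge_of_free_support`). Since `τ < ∞` for an isolated member (res-L0-w41-stub-3's
K1), an isolated member admits at most `τ + 1` consecutive free steps. [folklore] -/
theorem milnorLength_ge_of_substGenerators_eq {M d : ℕ} (hd : 2 ≤ d) (hM : 1 ≤ M) {F Ψ G : MvPowerSeries (Fin 3) K}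
    (h : substGenerators (R := K) (fun i : Fin 3 => Finsupp.single i 1 + if i = 0 then 0 else M • Finsupp.single 0 1)
      (chartExp_ne_zero 0 M) F = Ψ ^ 2 + X 0 ^ (M * d) * G) :
    ((M - 1 : ℕ) : ℕ∞) ≤ Module.length (MvPowerSeries (Fin 3) K)
      (MvPowerSeries (Fin 3) K ⧸ Ideal.span (Set.range fun i : Fin 3 => MvPowerSeries.pderiv i F)) :=
  milnorLength_ge_of_free_support hd hM F (free_support_of_substGenerators_eq h)

end Summit.ResolutionOfSingularities.ResolutionOfSingularities.Theorems.SwitchingDichotomy.G3Perf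

end
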